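import Mathlib
import HarnessLib
import Summits.HodgeConjecture.HodgeConjecture.Theses.HeckePrymWeil
import Literature.AlgebraicGeometry.Motives.FamiliesVHS
import Literature.AlgebraicTopology.SingularHomology.CupProduct

/-!
# Crux-ideate sketch (ideator 3, round 1) for `WeilVariationalHodge` (stmt-HodgeConjecture-14497)

First lemmas of the two idea cards, typed over existing declarations:

* Card `apz-sparse-isogeny-closing`: `AlgebraicLocusSigmaClosed` (Chow/Hilbert compactness: the
  fibrewise algebraicity locus of a global class is a countable increasing union of
  Zariski-closed-on-points strata) and the (trivial) topological closing step `sparse_closing`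
  (a Zariski-closed-on-points stratum containing a Zariski-dense set of points is everything); the
  André–Pink–Zannier input (Richard–Yafaev 2024/2025, Orr 2013) is what makes "infinitely many
  Hecke translates of the anchor inside one stratum" a Zariski-dense set — not typable yet (no Hecke
  orbits in the tree), so it stays informal on the card.
* Card `biquadratic-weil-splitting`: `cup_mem_eigenspace` — eigenclasses of a pull-back multiply
  under cup product (the typed shadow of "the K-Weil class is the cup product of two L-Weil classes
  on the CM-biquadratic special subvarieties").
-/

namespace Summit.HodgeConjecture.HodgeConjecture.Cruxes.WeilVariationalHodge.IdeatorThree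

open CategoryTheory
open Literature.AlgebraicGeometry.Motives Literature.AlgebraicGeometry.HodgeTheory
open Literature.AlgebraicTopology.SingularHomology

/-- **Chow compactness, typed for the crux's carriers.** For a smooth projective family
`f : 𝒳 ⟶ S` of relative dimension `2M` over a quasi-compact base and ANY global class
`W ∈ H^{2M}(𝒳(ℂ); ℂ)`, the set of complex points `s` at which `W|_{𝒳_s}` is algebraic is an
increasing countable union of Zariski-closed-on-points subsets `T d` ("`W|_s` lies in the span of
classes of subschemes drawn from the first `d` components of the relative Hilbert scheme";
properness of those components + local constancy of cycle classes). First lemma of card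
`apz-sparse-isogeny-closing`; the whole line is: some `T d` contains infinitely many Hecke
translates of the anchor ⇒ (APZ) `T d = S(ℂ)` ⇒ the crux. -/
def AlgebraicLocusSigmaClosed : Prop :=
  ∀ (M : ℕ) ⦃𝒳 S : SchemeOver ℂ⦄ (f : 𝒳 ⟶ S), IsSmoothProjectiveFamily f (2 * M) →
    CompactSpace S.left → AlgebraicGeometry.Smooth S.hom →
    ∀ W : complexBetti 𝒳 (2 * M),
      ∃ T : ℕ → Set (ComplexPoints S), Monotone T ∧ (∀ d, IsZariskiClosedOnPoints S (T d)) ∧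
        {s : ComplexPoints S |
            complexBetti.map (fiberι f s) (2 * M) W ∈ algebraicClasses (fiberOver f s) M} = ⋃ d, T d

/-- A set of complex points is **Zariski dense on points** if the only closed subset of `S`
containing all their underlying scheme points is `S` itself. -/
def IsZariskiDenseOnPoints (S : SchemeOver ℂ) (Λ : Set (ComplexPoints S)) : Prop :=
  ∀ Z : Set S.left, IsClosed Z → (∀ P ∈ Λ, P.pt ∈ Z) → Z = Set.univ

/-- **The closing step (topology only).** A Zariski-closed-on-points stratum that contains a
Zariski-dense-on-points set of complex points is all of `S(ℂ)`. In the line this is applied with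
`Λ` = infinitely many Hecke translates of the anchor lying in one stratum `T d`, whose Zariski
density is the André–Pink–Zannier theorem (Richard–Yafaev) for a Hodge-generic transcendental
anchor. -/
theorem sparse_closing {S : SchemeOver ℂ} {T Λ : Set (ComplexPoints S)}
    (hT : IsZariskiClosedOnPoints S T) (hΛ : Λ ⊆ T) (hd : IsZariskiDenseOnPoints S Λ) :
    T = Set.univ := by
  obtain ⟨Z, hZ, rfl⟩ := hT
  have hZu : Z = Set.univ := hd Z hZ (fun P hP => hΛ hP)
  ext P
  simp [hZu]

/-- **Consequence for the crux's shape**: if the algebraicity locus is a countable union of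
Zariski-closed-on-points strata and ONE stratum contains a Zariski-dense-on-points set, then the
class is algebraic at every complex point. -/
theorem algebraic_everywhere_of_dense_stratum {S : SchemeOver ℂ} {A : Set (ComplexPoints S)}
    {T : ℕ → Set (ComplexPoints S)} (hT : ∀ d, IsZariskiClosedOnPoints S (T d))
    (hA : A = ⋃ d, T d) {d₀ : ℕ} {Λ : Set (ComplexPoints S)} (hΛ : Λ ⊆ T d₀)
    (hd : IsZariskiDenseOnPoints S Λ) : A = Set.univ := by
  have h := sparse_closing (hT d₀) hΛ hd
  rw [hA, Set.eq_univ_iff_forall]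
  intro s
  exact Set.mem_iUnion.mpr ⟨d₀, by rw [h]; trivial⟩

/-- **Eigenclasses multiply under cup product** (typed shadow of the biquadratic splitting
`w_K = w_L ∪ w_L'`): for an endomorphism `g` of a `ℂ`-scheme `X`, if `a ∈ Hᵖ` and `b ∈ Hᵠ` are
eigenvectors of `g^*` with eigenvalues `μ`, `ν`, then `a ∪ b ∈ Hⁿ` is an eigenvector of `g^*` with
eigenvalue `μν` (naturality of the cup product, Hatcher Prop. 3.10). First lemma of card
`biquadratic-weil-splitting`. -/
theorem cup_mem_eigenspace {X : SchemeOver ℂ} (g : X ⟶ X) {p q n : ℕ} (h : p + q = n)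
    {a : complexBetti X p} {b : complexBetti X q} {μ ν : ℂ}
    (ha : a ∈ Module.End.eigenspace (complexBetti.map g p).hom μ)
    (hb : b ∈ Module.End.eigenspace (complexBetti.map g q).hom ν) :
    cupProduct h a b ∈ Module.End.eigenspace (complexBetti.map g n).hom (μ * ν) := by
  rw [Module.End.mem_eigenspace_iff] at ha hb ⊢
  have hnat := cupProduct_map (R := ℂ) (AlgPoints.mapContinuous (L := ℂ) g) h a b
  change (complexBetti.map g n).hom (cupProduct h a b) = _
  have e1 : (complexBetti.map g n).hom (cupProduct h a b)
      = cupProduct h ((complexBetti.map g p).hom a) ((complexBetti.map g q).hom b) := hnat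
  rw [e1, ha, hb, LinearMap.map_smul₂, LinearMap.map_smul, smul_smul]

end Summit.HodgeConjecture.HodgeConjecture.Cruxes.WeilVariationalHodge.IdeatorThree
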